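import Summits.Parity.BatemanHorn.Theorems.RoughValueTransportRoughValueLawLinearCells
import Literature.NumberTheory.Sieve.BatemanHornMertensProduct
import Literature.NumberTheory.Sieve.RoughCellDensity
import HarnessLib

/-!
# Route `RoughParitySectors`, crux `OddSectorShareLinear` (stmt-Parity-15629), line `birth`:
# the registered stub `stub_oneFormShare` (S'': the one-form share is the integer share)

`--supports stmt-Parity-15629` file of the checked skeleton
`Summits/Parity/BatemanHorn/Cruxes/OddSectorShareLinear/Lines/birth.lean`.  It PROVES the registered stub
`stub_oneFormShare` verbatim: for every all-linear Bateman–Horn system `f`, every member `m` and every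
`η > 0` there is `U₀` (here: any `U₀ > 2`) such that for `U ≥ U₀`, eventually in `x`,
`|Q_m·O_ℤ − N_m·P_ℤ| ≤ η·N_m·P_ℤ`, where `Q_m, N_m` count `1 ≤ n ≤ x` with `f_m(n) > 0`, `f_m(n)` free
of primes `< ⌈x^{1/U}⌉₊`, and `Ω(f_m(n)) = 1` resp. odd, and `P_ℤ, O_ℤ` are the same cells of the integers.

Route: member `m` is `αX + β` with `α ≥ 1`, `(β mod α, α) = 1` (`isBatemanHornSystem_single`,
`IncrementAnchoring.LinearRoughValueLaw.const_of_linear`); the tree's linear cell law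
`OmegaClassShapeSplit.LinearCells.tendsto_card_filter_linear_cell` gives `cell_j·log x/x → (α/φ(α))·I_j(U)`
for the form and (at `α = 1, β = 0`) `→ I_j(U)` for the integers; rough values have `Ω ≤ ⌈U⌉₊ + 1`
eventually, so the odd cells are finite sums of `Ω = j` cells; both products, normalised by `(log x/x)²`,
tend to `(α/φ(α))·T(U)`, `T(U) = Σ_{j odd} I_j(U) ≥ I_1(U) = 1 > 0`.  Everything used is PROVED in the
tree; no definition and no new fact is introduced.

References: K. Alladi, Quart. J. Math. Oxford (2) 33 (1982) 129–148, Thm 1 [Alladi1982];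
G. Tenenbaum, *Introduction to analytic and probabilistic number theory*, III.6 [Tenenbaum2015].
-/

noncomputable section

open Filter Finset Polynomial
open scoped BigOperators Topology ArithmeticFunction.Omega
open Literature.NumberTheory.Sieve

namespace Summit.Parity.BatemanHorn.Cruxes.OddSectorShareLinear.Birth

namespace OneFormShare

open Summit.Parity.BatemanHorn.Cruxes.RoughValueLaw
open Summit.Parity.BatemanHorn.Cruxes.RoughValueLaw.OmegaClassShapeSplit

/-! ### Counting: the odd cell is a finite union of `Ω`-cells -/

/-- If `g ≤ J` on `s`, the elements of `s` with `g` odd are those with `g = i + 1`, `i < J` even: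
`#{a ∈ s : g a odd} = Σ_{i < J, i even} #{a ∈ s : g a = i + 1}`. [folklore] -/
theorem card_filter_odd_eq_sum {ι : Type*} [DecidableEq ι] (s : Finset ι) (g : ι → ℕ) {J : ℕ}
    (hJ : ∀ a ∈ s, g a ≤ J) :
    #(s.filter (fun a => Odd (g a))) =
      ∑ i ∈ (range J).filter Even, #(s.filter (fun a => g a = i + 1)) := by
  rw [← card_biUnion]
  · congr 1
    ext a
    simp only [mem_filter, mem_biUnion, mem_range]
    constructor
    · rintro ⟨ha, r, hr⟩
      exact ⟨2 * r, ⟨by have := hJ a ha; omega, even_two_mul r⟩, ha, hr⟩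
    · rintro ⟨i, ⟨-, r, hr⟩, ha, hga⟩
      exact ⟨ha, r, by omega⟩
  · intro i _ j _ hij
    exact disjoint_filter.mpr fun a _ h1 h2 => hij (by omega)

/-- The integers as the linear form `1·n + 0`: for `1 ≤ n ≤ x`, `0 < 1·n + 0`, `(p : ℤ) ∣ 1·n + 0 ↔ p ∣ n`
and `(1·n + 0).toNat = n`, so the integers' sifted cells are the `α = 1, β = 0` case of the cells of
`OmegaClassShapeSplit.LinearCells.tendsto_card_filter_linear_cell`. [folklore] -/
theorem filter_filter_eq_linear (x T : ℕ) (P : ℕ → Prop) [DecidablePred P] :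
    ((Icc 1 x).filter (fun n : ℕ => ∀ p ∈ range T, p.Prime → ¬ (p ∣ n))).filter
        (fun n : ℕ => P (Ω n)) =
      (Icc 1 x).filter (fun n : ℕ => (0 < (1 : ℤ) * n + 0 ∧
        ∀ p ∈ range T, p.Prime → ¬ ((p : ℤ) ∣ (1 : ℤ) * n + 0)) ∧ P (Ω ((1 : ℤ) * n + 0).toNat)) := by
  rw [filter_filter]
  refine filter_congr fun n hn => ?_
  have hn0 : (0 : ℤ) < n := by have := (mem_Icc.mp hn).1; omega
  simp only [one_mul, add_zero, Int.toNat_natCast, Int.natCast_dvd_natCast, hn0, true_and]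

/-- `filter_filter_eq_linear` for the cell `Ω = j`. [folklore] -/
theorem filter_filter_eq_linear_eq (x T j : ℕ) :
    ((Icc 1 x).filter (fun n : ℕ => ∀ p ∈ range T, p.Prime → ¬ (p ∣ n))).filter
        (fun n : ℕ => Ω n = j) =
      (Icc 1 x).filter (fun n : ℕ => (0 < (1 : ℤ) * n + 0 ∧
        ∀ p ∈ range T, p.Prime → ¬ ((p : ℤ) ∣ (1 : ℤ) * n + 0)) ∧ Ω ((1 : ℤ) * n + 0).toNat = j) :=
  filter_filter_eq_linear x T (· = j)

/-- `filter_filter_eq_linear` for the odd cell. [folklore] -/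
theorem filter_filter_eq_linear_odd (x T : ℕ) :
    ((Icc 1 x).filter (fun n : ℕ => ∀ p ∈ range T, p.Prime → ¬ (p ∣ n))).filter
        (fun n : ℕ => Odd (Ω n)) =
      (Icc 1 x).filter (fun n : ℕ => (0 < (1 : ℤ) * n + 0 ∧
        ∀ p ∈ range T, p.Prime → ¬ ((p : ℤ) ∣ (1 : ℤ) * n + 0)) ∧
          Odd (Ω ((1 : ℤ) * n + 0).toNat)) :=
  filter_filter_eq_linear x T (fun j => Odd j)

/-! ### The rough values of `αn + β` have `Ω ≤ ⌈u⌉ + 1`, eventually -/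

/-- For `α ≥ 1`, `u > 2` and all large `x`: every `1 ≤ n ≤ x` with `αn + β > 0` free of primes
`< ⌈x^{1/u}⌉` has `Ω(αn + β) ≤ ⌈u⌉ + 1` (`(x^{1/u})^{Ω} ≤ αn + β ≤ αx + β` and
`log(αx + β) ≤ (⌈u⌉ + 1) log x^{1/u}`, `LinearCells.eventually_ranges`). [folklore] -/
theorem eventually_cardFactors_le {α β : ℤ} (hα : 0 < α) {u : ℝ} (hu : 2 < u) :
    ∀ᶠ x : ℕ in atTop, ∀ n ∈ (Icc 1 x).filter (fun n : ℕ => 0 < α * n + β ∧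
        ∀ p ∈ range ⌈(x : ℝ) ^ (1 / u)⌉₊, p.Prime → ¬ ((p : ℤ) ∣ α * n + β)),
      Ω (α * n + β).toNat ≤ ⌈u⌉₊ + 1 := by
  filter_upwards [LinearCells.eventually_ranges (β := β) hα hu] with x hx n hn
  obtain ⟨-, -, hz2, -, hzX, hlogle, -⟩ := hx
  set z : ℝ := (x : ℝ) ^ (1 / u)
  set J : ℕ := ⌈u⌉₊ + 1
  have hr := (mem_filter.mp (mem_filter.mp (LinearCells.toNat_mem_filter hα hn)).1).1
  have hpow := pow_cardFactors_le_of_mem_roughIcc hr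
  have hvle := (mem_roughIcc.mp hr).1.2
  set k : ℕ := Ω (α * n + β).toNat
  by_contra hlt
  push Not at hlt
  have hz1 : (1 : ℝ) ≤ z := by linarith
  have hz0 : (0 : ℝ) < z := by linarith
  have hzc : z ≤ (⌈z⌉₊ : ℝ) := Nat.le_ceil z
  have hX0 : (0 : ℝ) ≤ (α : ℝ) * x + β := by linarith
  have h1 : z ^ (J + 1) ≤ (α : ℝ) * x + β :=
    calc z ^ (J + 1) ≤ z ^ k := pow_le_pow_right₀ hz1 hlt
      _ ≤ (⌈z⌉₊ : ℝ) ^ k := pow_le_pow_left₀ hz0.le hzc k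
      _ ≤ (((α * n + β).toNat : ℕ) : ℝ) := by exact_mod_cast hpow
      _ ≤ ((⌊(α : ℝ) * x + β⌋₊ : ℕ) : ℝ) := by exact_mod_cast hvle
      _ ≤ (α : ℝ) * x + β := Nat.floor_le hX0
  have h2 : Real.log (z ^ (J + 1)) ≤ (J : ℝ) * Real.log z :=
    (Real.log_le_log (pow_pos hz0 _) h1).trans hlogle
  rw [Real.log_pow, Nat.cast_add, Nat.cast_one] at h2
  have hlogz : 0 < Real.log z := Real.log_pos (by linarith)
  linarith

/-! ### The four cell asymptotics -/

/-- **The prime cell of `αn + β`**: `#{1 ≤ n ≤ x : αn + β > 0, p < ⌈x^{1/u}⌉ prime ⇒ p ∤ αn + β,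
Ω(αn + β) = 1}·(log x)/x → α/φ(α)` (`LinearCells.tendsto_card_filter_linear_cell` at `j = 0`,
`I_1(u) = 1`). [folklore] -/
theorem tendsto_card_filter_one {α β : ℤ} (hα : 0 < α)
    (hcop : ((β % α).toNat).Coprime α.toNat) {u : ℝ} (hu : 2 < u) :
    Tendsto (fun x : ℕ => (#((Icc 1 x).filter (fun n : ℕ => (0 < α * n + β ∧
        ∀ p ∈ range ⌈(x : ℝ) ^ (1 / u)⌉₊, p.Prime → ¬ ((p : ℤ) ∣ α * n + β)) ∧
          Ω (α * n + β).toNat = 1)) : ℝ) * Real.log x / x) atTop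
      (𝓝 ((α : ℝ) / (((α.toNat).totient : ℕ) : ℝ))) := by
  have h := LinearCells.tendsto_card_filter_linear_cell hα hcop 0 hu
  rw [zero_add, roughCellDensity_one_of_one_le (by linarith), mul_one] at h
  exact h

/-- **The odd cell of `αn + β`**: `#{1 ≤ n ≤ x : αn + β > 0, p < ⌈x^{1/u}⌉ prime ⇒ p ∤ αn + β,
Ω(αn + β) odd}·(log x)/x → (α/φ(α)) Σ_{i ≤ ⌈u⌉, i even} I_{i+1}(u)`: eventually the odd cell is the
disjoint union of the cells `Ω = i + 1`, `i ≤ ⌈u⌉` even (`eventually_cardFactors_le`,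
`card_filter_odd_eq_sum`), each with its limit (`LinearCells.tendsto_card_filter_linear_cell`).
[folklore] -/
theorem tendsto_card_filter_odd {α β : ℤ} (hα : 0 < α)
    (hcop : ((β % α).toNat).Coprime α.toNat) {u : ℝ} (hu : 2 < u) :
    Tendsto (fun x : ℕ => (#((Icc 1 x).filter (fun n : ℕ => (0 < α * n + β ∧
        ∀ p ∈ range ⌈(x : ℝ) ^ (1 / u)⌉₊, p.Prime → ¬ ((p : ℤ) ∣ α * n + β)) ∧
          Odd (Ω (α * n + β).toNat))) : ℝ) * Real.log x / x) atTop
      (𝓝 ((α : ℝ) / (((α.toNat).totient : ℕ) : ℝ) *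
        ∑ i ∈ (range (⌈u⌉₊ + 1)).filter Even, roughCellDensity (i + 1) u)) := by
  have hsum := tendsto_finsetSum ((range (⌈u⌉₊ + 1)).filter Even)
    (fun i _ => LinearCells.tendsto_card_filter_linear_cell hα hcop i hu)
  rw [← mul_sum] at hsum
  refine hsum.congr' ?_
  filter_upwards [eventually_cardFactors_le (β := β) hα hu] with x hx
  have h := card_filter_odd_eq_sum _ (fun n : ℕ => Ω (α * n + β).toNat) hx
  simp only [filter_filter] at h
  rw [h, Nat.cast_sum, sum_mul, sum_div]

/-- **Relative closeness from a common positive limit**: if `A, B → L > 0` then, for `η > 0`,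
eventually `|A − B| ≤ η B` (`B ≥ L/2` and `|A − B| ≤ η L/2` eventually). [folklore] -/
theorem eventually_abs_sub_le_mul {A B : ℕ → ℝ} {L η : ℝ} (hL : 0 < L) (hη : 0 < η)
    (hA : Tendsto A atTop (𝓝 L)) (hB : Tendsto B atTop (𝓝 L)) :
    ∀ᶠ x in atTop, |A x - B x| ≤ η * B x := by
  have hsub : Tendsto (fun x => A x - B x) atTop (𝓝 0) := by
    have h := hA.sub hB
    rwa [sub_self] at h
  have hε : 0 < η * (L / 2) := by positivity
  filter_upwards [hB.eventually_const_le (half_lt_self hL), Metric.tendsto_nhds.mp hsub _ hε]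
    with x hBx hsx
  rw [Real.dist_eq, sub_zero] at hsx
  calc |A x - B x| ≤ η * (L / 2) := hsx.le
    _ ≤ η * B x := mul_le_mul_of_nonneg_left hBx hη.le

/-! ### The share identity for a linear form -/

/-- **S'' for the linear form `αn + β`** (`α ≥ 1`, the class `β mod α` prime to `α`, `U > 2`,
`η > 0`): eventually in `x`, `|Q·O_ℤ − N·P_ℤ| ≤ η·N·P_ℤ`, where `Q, N` are the prime and the odd
cell of the `⌈x^{1/U}⌉`-rough values `αn + β`, `1 ≤ n ≤ x`, and `P_ℤ, O_ℤ` those of the integers: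
`Q·O_ℤ·(log x/x)²` and `N·P_ℤ·(log x/x)²` both tend to `(α/φ(α))·T(U)`,
`T(U) = Σ_{i ≤ ⌈U⌉ even} I_{i+1}(U) ≥ I_1(U) = 1`. [folklore] -/
theorem main {α β : ℤ} (hα : 0 < α) (hcop : ((β % α).toNat).Coprime α.toNat) {η : ℝ}
    (hη : 0 < η) {U : ℝ} (hU : 2 < U) :
    ∀ᶠ x : ℕ in atTop,
      |(#((Icc 1 x).filter (fun n : ℕ => (0 < α * n + β ∧
          ∀ p ∈ range ⌈(x : ℝ) ^ (1 / U)⌉₊, p.Prime → ¬ ((p : ℤ) ∣ α * n + β)) ∧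
            Ω (α * n + β).toNat = 1)) : ℝ) *
        (#(((Icc 1 x).filter (fun n : ℕ => ∀ p ∈ range ⌈(x : ℝ) ^ (1 / U)⌉₊, p.Prime →
          ¬ (p ∣ n))).filter (fun n : ℕ => Odd (Ω n))) : ℝ) -
       (#((Icc 1 x).filter (fun n : ℕ => (0 < α * n + β ∧
          ∀ p ∈ range ⌈(x : ℝ) ^ (1 / U)⌉₊, p.Prime → ¬ ((p : ℤ) ∣ α * n + β)) ∧
            Odd (Ω (α * n + β).toNat))) : ℝ) *
        (#(((Icc 1 x).filter (fun n : ℕ => ∀ p ∈ range ⌈(x : ℝ) ^ (1 / U)⌉₊, p.Prime →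
          ¬ (p ∣ n))).filter (fun n : ℕ => Ω n = 1)) : ℝ)| ≤
      η * ((#((Icc 1 x).filter (fun n : ℕ => (0 < α * n + β ∧
          ∀ p ∈ range ⌈(x : ℝ) ^ (1 / U)⌉₊, p.Prime → ¬ ((p : ℤ) ∣ α * n + β)) ∧
            Odd (Ω (α * n + β).toNat))) : ℝ) *
        (#(((Icc 1 x).filter (fun n : ℕ => ∀ p ∈ range ⌈(x : ℝ) ^ (1 / U)⌉₊, p.Prime →
          ¬ (p ∣ n))).filter (fun n : ℕ => Ω n = 1)) : ℝ)) := by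
  -- names for the four counts
  obtain ⟨Q, hQ⟩ : ∃ g : ℕ → ℝ, ∀ x : ℕ, g x = (#((Icc 1 x).filter (fun n : ℕ => (0 < α * n + β ∧
      ∀ p ∈ range ⌈(x : ℝ) ^ (1 / U)⌉₊, p.Prime → ¬ ((p : ℤ) ∣ α * n + β)) ∧
        Ω (α * n + β).toNat = 1)) : ℝ) := ⟨_, fun _ => rfl⟩
  obtain ⟨N, hN⟩ : ∃ g : ℕ → ℝ, ∀ x : ℕ, g x = (#((Icc 1 x).filter (fun n : ℕ => (0 < α * n + β ∧
      ∀ p ∈ range ⌈(x : ℝ) ^ (1 / U)⌉₊, p.Prime → ¬ ((p : ℤ) ∣ α * n + β)) ∧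
        Odd (Ω (α * n + β).toNat))) : ℝ) := ⟨_, fun _ => rfl⟩
  obtain ⟨Pz, hPz⟩ : ∃ g : ℕ → ℝ, ∀ x : ℕ, g x = (#(((Icc 1 x).filter (fun n : ℕ =>
      ∀ p ∈ range ⌈(x : ℝ) ^ (1 / U)⌉₊, p.Prime → ¬ (p ∣ n))).filter
        (fun n : ℕ => Ω n = 1)) : ℝ) := ⟨_, fun _ => rfl⟩
  obtain ⟨Oz, hOz⟩ : ∃ g : ℕ → ℝ, ∀ x : ℕ, g x = (#(((Icc 1 x).filter (fun n : ℕ =>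
      ∀ p ∈ range ⌈(x : ℝ) ^ (1 / U)⌉₊, p.Prime → ¬ (p ∣ n))).filter
        (fun n : ℕ => Odd (Ω n))) : ℝ) := ⟨_, fun _ => rfl⟩
  -- the common limit `c·T > 0`
  set c : ℝ := (α : ℝ) / (((α.toNat).totient : ℕ) : ℝ)
  set T : ℝ := ∑ i ∈ (range (⌈U⌉₊ + 1)).filter Even, roughCellDensity (i + 1) U
  have hU1 : (1 : ℝ) ≤ U := by linarith
  have hc : 0 < c := by
    have ha0 : 0 < α.toNat := by omega
    have hφ : (0 : ℝ) < (((α.toNat).totient : ℕ) : ℝ) := by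
      exact_mod_cast Nat.totient_pos.mpr ha0
    have hαR : (0 : ℝ) < α := by exact_mod_cast hα
    exact div_pos hαR hφ
  have hT : 1 ≤ T := by
    have h0 : (0 : ℕ) ∈ (range (⌈U⌉₊ + 1)).filter Even :=
      mem_filter.mpr ⟨mem_range.mpr (Nat.succ_pos _), Even.zero⟩
    have h := single_le_sum (f := fun i => roughCellDensity (i + 1) U)
      (fun i _ => roughCellDensity_nonneg (i + 1) U) h0
    rwa [zero_add, roughCellDensity_one_of_one_le hU1] at h
  have hL : 0 < c * T := mul_pos hc (by linarith)
  -- the four limits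
  have hQt : Tendsto (fun x => Q x * Real.log x / x) atTop (𝓝 c) :=
    (tendsto_card_filter_one hα hcop hU).congr fun x => by rw [hQ]
  have hNt : Tendsto (fun x => N x * Real.log x / x) atTop (𝓝 (c * T)) :=
    (tendsto_card_filter_odd hα hcop hU).congr fun x => by rw [hN]
  have hcop1 : (((0 : ℤ) % 1).toNat).Coprime (1 : ℤ).toNat := Nat.coprime_one_right _
  have e1 : ((1 : ℤ) : ℝ) / (((((1 : ℤ).toNat).totient : ℕ) : ℝ)) = 1 := by
    rw [Int.toNat_one, Nat.totient_one, Nat.cast_one, Int.cast_one, div_one]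
  have hPt : Tendsto (fun x => Pz x * Real.log x / x) atTop (𝓝 1) := by
    have h := tendsto_card_filter_one (β := 0) one_pos hcop1 hU
    rw [e1] at h
    refine h.congr fun x => ?_
    rw [hPz, filter_filter_eq_linear_eq]
  have hOt : Tendsto (fun x => Oz x * Real.log x / x) atTop (𝓝 T) := by
    have h := tendsto_card_filter_odd (β := 0) one_pos hcop1 hU
    rw [e1, one_mul] at h
    refine h.congr fun x => ?_
    rw [hOz, filter_filter_eq_linear_odd]
  -- the two products have the same positive limit
  have hA : Tendsto (fun x => Q x * Real.log x / x * (Oz x * Real.log x / x)) atTop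
      (𝓝 (c * T)) := hQt.mul hOt
  have hB : Tendsto (fun x => N x * Real.log x / x * (Pz x * Real.log x / x)) atTop
      (𝓝 (c * T)) := by
    have h := hNt.mul hPt
    rwa [mul_one] at h
  filter_upwards [eventually_abs_sub_le_mul hL hη hA hB, eventually_gt_atTop 1] with x hx hx1
  have hx1R : (1 : ℝ) < x := by exact_mod_cast hx1
  have hlog : 0 < Real.log x := Real.log_pos hx1R
  have hx0 : (0 : ℝ) < x := by linarith
  have hw : 0 < (Real.log x / x) ^ 2 := by positivity
  have r1 : Q x * Real.log x / x * (Oz x * Real.log x / x) - N x * Real.log x / x *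
      (Pz x * Real.log x / x) = (Q x * Oz x - N x * Pz x) * (Real.log x / x) ^ 2 := by ring
  have r2 : η * (N x * Real.log x / x * (Pz x * Real.log x / x)) =
      η * (N x * Pz x) * (Real.log x / x) ^ 2 := by ring
  rw [r1, r2, abs_mul, abs_of_pos hw] at hx
  have key := le_of_mul_le_mul_right hx hw
  simpa only [hQ, hN, hPz, hOz] using key

end OneFormShare

/-- **Stub (S''): one-form share** — registered stub `stub_oneFormShare` of crux stmt-Parity-15629
(line `birth`), verbatim: member `m`'s one-form prime-within-odd share inside the `x^{1/U}`-rough values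
equals the integers' prime-within-odd share at the same `(x, U)`, for every fixed `U > 2`, eventually in
`x` (Alladi's Ω-cells along the progression `β mod α` and for the integers). [folklore] -/
theorem stub_oneFormShare :
    ∀ (k : ℕ) (f : Fin k → Polynomial ℤ), Literature.NumberTheory.Sieve.IsBatemanHornSystem f → (∀
    i, (f i).natDegree ≤ 1) → ∀ (m : Fin k) (η : ℝ), 0 < η → ∃ U₀ : ℝ, ∀ U : ℝ, U₀ ≤ U → ∀ᶠ x : ℕ in
    Filter.atTop, |((((Finset.Icc 1 x).filter (fun n : ℕ => (0 < (f m).eval (n : ℤ) ∧ ∀ p ∈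
    Finset.range ⌈(x : ℝ) ^ (((f m).natDegree : ℝ) / U)⌉₊, p.Prime → ¬ ((p : ℤ) ∣ (f m).eval (n :
    ℤ))) ∧ ArithmeticFunction.cardFactors (((f m).eval (n : ℤ)).toNat) = 1)).card : ℕ) : ℝ) *
    (((((Finset.Icc 1 x).filter (fun n : ℕ => ∀ p ∈ Finset.range ⌈(x : ℝ) ^ (1 / U)⌉₊, p.Prime → ¬
    (p ∣ n))).filter (fun n : ℕ => Odd (ArithmeticFunction.cardFactors n))).card : ℕ) : ℝ) -
    ((((Finset.Icc 1 x).filter (fun n : ℕ => (0 < (f m).eval (n : ℤ) ∧ ∀ p ∈ Finset.range ⌈(x : ℝ) ^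
    (((f m).natDegree : ℝ) / U)⌉₊, p.Prime → ¬ ((p : ℤ) ∣ (f m).eval (n : ℤ))) ∧ Odd
    (ArithmeticFunction.cardFactors (((f m).eval (n : ℤ)).toNat)))).card : ℕ) : ℝ) * (((((Finset.Icc
    1 x).filter (fun n : ℕ => ∀ p ∈ Finset.range ⌈(x : ℝ) ^ (1 / U)⌉₊, p.Prime → ¬ (p ∣ n))).filter
    (fun n : ℕ => ArithmeticFunction.cardFactors n = 1)).card : ℕ) : ℝ)| ≤ η * (((((Finset.Icc 1
    x).filter (fun n : ℕ => (0 < (f m).eval (n : ℤ) ∧ ∀ p ∈ Finset.range ⌈(x : ℝ) ^ (((f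
    m).natDegree : ℝ) / U)⌉₊, p.Prime → ¬ ((p : ℤ) ∣ (f m).eval (n : ℤ))) ∧ Odd
    (ArithmeticFunction.cardFactors (((f m).eval (n : ℤ)).toNat)))).card : ℕ) : ℝ) * (((((Finset.Icc
    1 x).filter (fun n : ℕ => ∀ p ∈ Finset.range ⌈(x : ℝ) ^ (1 / U)⌉₊, p.Prime → ¬ (p ∣ n))).filter
    (fun n : ℕ => ArithmeticFunction.cardFactors n = 1)).card : ℕ) : ℝ)) := by
  intro k f hf hdeg m η hη
  refine ⟨3, fun U hU => ?_⟩
  have hU2 : (2 : ℝ) < U := by linarith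
  have hdeg1 : (f m).natDegree = 1 := by have := hf.natDegree_pos m; have := hdeg m; omega
  obtain ⟨hα, hcop, -⟩ :=
    RoughValueLaw.IncrementAnchoring.LinearRoughValueLaw.const_of_linear (f := ![f m])
      (BatemanHornMertens.isBatemanHornSystem_single hf m) hdeg1
  simp only [Matrix.cons_val_zero] at hα hcop
  have hg : ∀ n : ℕ, (f m).eval (n : ℤ) = (f m).coeff 1 * n + (f m).coeff 0 := fun n => by
    conv_lhs => rw [eq_X_add_C_of_natDegree_le_one (hdeg m)]
    simp only [eval_add, eval_mul, eval_C, eval_X]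
  simp only [hg, hdeg1, Nat.cast_one]
  exact OneFormShare.main hα hcop hη hU2

end Summit.Parity.BatemanHorn.Cruxes.OddSectorShareLinear.Birth

end
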